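import Literature.Analysis.FluidPDE.NSCriticalClosureBesovBounded
import Literature.Analysis.FluidPDE.BesovMildWeak
import Literature.Analysis.FluidPDE.KochTataru
import HarnessLib

/-!
# Bounded mild solutions are classical: the Oseen-kernel architecture of KNSS 2009, §§3–4

Analysis/FluidPDE decomposition file for the named fact
`Literature.Analysis.FluidPDE.knss_classical_of_bounded_isBesovMildSolutionOn`
(`NSCriticalClosureBesovBounded.lean`; Koch–Nadirashvili–Seregin–Šverák, Acta Math. 203 (2009)
= arXiv:0709.3599, §§3–4): a Besov mild solution `(u, U)` on `[0, T)` (duality form of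
`CriticalRegularity.lean`) whose slices are uniformly essentially bounded on every `(0, T₁)`,
`T₁ < T`, agrees at every `t ∈ (0, T)`, a.e., with a classical solution on `(0, T)`.

The printed theory (KNSS §4, arXiv p. 8: "a function `u ∈ L^∞_{x,t}` is defined to be (i) a
*mild* solution … if [the representation formula `uᵢ = Γ ∗ u₀ᵢ + ∫₀ᵗ∫ K_{ijk}(x-y,t-s)
f_{jk}(y,s) dy ds` of §3, p. 6] is valid with `f_k = -u_k u`", Prop. 4.1: "`t^{k/2+l} ∇ᵏₓ ∂ₜˡ u`
are bounded") is a theory of the **Oseen-kernel integral equation**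
`u(t) = e^{ν(t-s)Δ} u(s) - ∫ₛᵗ e^{ν(t-τ)Δ} P ∇·(u ⊗ u)(τ) dτ` (KNSS §3, `u(t) = S(t)u₀ +
∫₀ᵗ S(t-s)P∂ₖf_k(s) ds`, p. 6; Lemarié-Rieusset 2016, Thm. 6.1 (6.12)), whose kernel `K(σ, z)[a, b]` of `e^{σΔ} P ∇·` on rank-one tensors is the
tree's `Literature.Analysis.FluidPDE.oseenKernel` (`KochTataru.lean`, Koch–Tataru 2001, (8), with
the bound (14) proved in `KochTataruKernel.lean`). This file makes that architecture explicit
for general viscosity and initial time and reduces the smoothing fact to four named facts, the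
reduction being **proved**:

* `oseenDuhamel ν s u v t x = ∫_{τ ∈ (s,t)} ∫ K(ν(t-τ), x-y)[u(τ,y), v(τ,y)] dy dτ`, the bilinear
  Duhamel term `∫ₛᵗ e^{ν(t-τ)Δ} P ∇·(u ⊗ v) dτ` (so that `kochTataruBilinear = oseenDuhamel 1 0`,
  `kochTataruBilinear_eq_oseenDuhamel`);
* (A) `oseenMild_of_bounded_isBesovMildSolutionOn` — **duality form ⇒ integral form** for
  bounded Besov mild solutions: `u(t) = e^{νtΔ} u(0) - B^ν_0(u,u)(t)` a.e., for every
  `t ∈ (0, T)` (Lemarié-Rieusset 2016, Thm. 6.1 with Prop. 6.5 and Lemma 6.4 (B): a very weak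
  solution vanishing at infinity is an Oseen solution; KNSS Lemma 3.1 / Rem. 3.1 is the `L^∞`
  statement with the parasitic drift `b(t)`, which the realisation condition `Ṡ_j U(t) → 0`
  of `MemHomBesov` (BCD Def. 1.26) rules out — this is where the Besov hypothesis enters);
* (R) `oseenMild_restart` — **restart** of the integral equation at a positive time
  `0 < s < t`: `u(t) = e^{ν(t-s)Δ} u(s) - B^ν_s(u,u)(t)` a.e. (semigroup laws of the heat and
  Oseen kernels; KNSS §4, p. 8: `u = U + B(u,u)` "as an ODE in `t`"; Lemarié-Rieusset 2016,
  proof of Thm. 9.12,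
  (9.38) with `V₀ = W_{ν(t-t₀)} ∗ u(t₀)`);
* (P) `knss2009_smoothing` — **KNSS Prop. 4.1**: a bounded solution of the integral equation
  from an `L^∞` datum on `(s, T₁)` is (represented by) a jointly smooth function with
  `(t-s)^{k/2+l} ∇ᵏₓ ∂ₜˡ u` bounded on `(s, T₁) × E` for all `k, l`;
* (C) `classical_of_smooth_isMildNSSolutionOn` — **smooth mild solutions are classical**: a
  jointly smooth field with bounded slices satisfying the duality-form identities from a datum
  integrable against Gaussians satisfies the momentum equation against divergence-free tests,
  hence is classical for a smooth pressure (Fabes–Jones–Rivière 1972, Thm. 2.1; the pressure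
  by `exists_isClassicalNSSolutionOn_of_forall_integral_inner_eq_zero`,
  `PressureReconstruction.lean`);
* `knss_classical_of_bounded_isBesovMildSolutionOn_of_oseen : (A) → (R) → (P) → (C) → fact`,
  **proved**: with `w_s(t) = e^{ν(t-s)Δ} u(s) - B^ν_s(u,u)(t)` the smooth representatives of (P)
  on `(s, T₁)`, any two agree where both are defined (continuous slices a.e. equal to `u(t)`),
  so `v(t) = w_{t/2}(t)` is jointly smooth on `(0, T) × ℝ³`, agrees with `u(t)` a.e. for every
  `t`, inherits the duality-form identities from `u`, and (C) applies.

## Why this shape (design notes)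

* **No drift.** Testing from the datum at each fixed `t` (the tree's `IsMildNSSolutionFrom`)
  pins `u(t)` against `e^{νtΔ}u(0) - B^ν_0(u,u)(t)` up to a field orthogonal to solenoidal tests
  and weakly divergence free, i.e. up to a harmonic (tempered) polynomial, which the realisation
  condition at times `t` and `0` kills; KNSS's `b(t)` (Lemma 3.1, for datum-free weak
  solutions) never appears. The bridge mild ⇒ KNSS-weak (`ForwardMildWeak.lean`) is the other
  route; both end in `PressureReconstruction.lean`.
* **A.e. level.** (A), (R) and the hypothesis of (P) are identities `u t =ᵐ …` between the
  given (merely measurable) field and everywhere-defined absolutely convergent integrals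
  (`heatExtension`, `oseenDuhamel`; for fields bounded on `(s, T₁)` the kernel bound
  `∫ ‖K(σ, z)[a,b]‖ dz ≤ C σ^{-1/2} ‖a‖ ‖b‖`, `exists_lintegral_enorm_oseenKernel_le`, makes
  `oseenDuhamel` converge absolutely); the smooth object is the right-hand side, as in KNSS
  ("`u ∈ L^∞_{x,t}`" is a class).
* **The datum** `u(0)` is not bounded (only `U 0 ∈ Ḃ^{-1+3/p}_{p,q}`); it enters
  `heatExtension (u 0)` through `∫ G_{νt}(y) u(0, x - y) dy`, absolutely convergent because a
  field with a tempered distribution is integrable against Gaussians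
  (`IsDistributionOf.integrable_heatKernel_mul_norm`).
* Not vendored: the quantitative short-time form of Prop. 4.1
  (`‖t^{k/2+l}∇ᵏ∂ₜˡu‖ ≤ C(k,l)‖u₀‖_∞` for `T' = ε(k,l)‖u₀‖_∞^{-2}`) and Lemma 4.1 (compactness),
  which the smoothing fact does not need.

## What remains (the DAG)

`knss_classical_of_bounded_isBesovMildSolutionOn_holds` ⇐ (A), (R), (P), (C), and
* (C) ⇐ the space–time weak form on the open slab `(0, T)` (the duality identities integrated in
  time against `∂ₜψ + νΔψ`, as in `ForwardMildWeak.lean`, the free term being handled by the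
  Gaussian envelope of `e^{νtΔ}Λ(t)` since the datum is only integrable against Gaussians),
  localisation with `ψ = η(t)φ(x)` and du Bois-Reymond in `t`, then `PressureReconstruction.lean`;
* (R) ⇐ `heatExtension_add_holds` (bounded data), the semigroup law `e^{aΔ}K(b) = K(a+b)` of the
  Oseen kernel and Fubini under the kernel bound (14);
* (A) ⇐ the adjoint identity `∫⟪K(σ,x-y)[a,b], φ(x)⟫dx = -⟪b, D(e^{σΔ}φ)(y) a⟫` for solenoidal
  `φ`, `div_z K = 0`, the annihilator lemma (`BoundedAnnihilator.lean`) and the Littlewood–Paley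
  facts `Ṡ_j e^{tΔ} = e^{tΔ} Ṡ_j`, `e^{tΔ} Ḃ^{s_p}_{p,q} ⊂ L^∞` (`LittlewoodPaley*Proofs.lean`);
* (P) ⇐ Picard iteration in the weighted spaces `sup (t-s)^{k/2}‖∇ᵏ·‖_∞` (KNSS p. 8: "The key
  is an estimate of `B` with the same form as [`‖B(u,v)‖ ≤ C√T ‖u‖ ‖v‖`] but in spaces with
  norms given by [`‖t^{k/2+l}∇ᵏₓ∂ₜˡu‖_∞`]"), uniqueness of bounded solutions on short intervals,
  and the time-derivative estimate `‖∇ᵏₓuₜ‖_∞ ≤ C(T,k)‖∇ᵏ⁺²ₓ f‖_∞` of §3, p. 6.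

## References

* G. Koch, N. Nadirashvili, G. Seregin, V. Šverák, *Liouville theorems for the Navier–Stokes
  equations and applications*, Acta Math. 203 (2009) 83–105 = arXiv:0709.3599 (arXiv page
  numbers): §3, pp. 6–7 (the kernels `K_{ij}`, `K_{ijk}` and their bounds, the representation
  formula, mild and weak solutions of the Stokes problem, Lemma 3.1, Rem. 3.1); §4, p. 8 (mild
  and weak solutions of Navier–Stokes, Rem. 4.1, `B(u,v)`, `u = U + B(u,u)`, Prop. 4.1,
  Lemma 4.1, the `L^∞` bounds for `∇ᵏₓu` and `∇ᵏₓ∂ₜ(u - b)`). [KochNadirashviliSereginSverak2009]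
* P. G. Lemarié-Rieusset, *The Navier–Stokes problem in the 21st century*, CRC Press 2016
  (held), Def. 6.5, Lemma 6.4, Prop. 6.4 (6.10), Thm. 6.1 (6.11)–(6.12), Prop. 6.5 (pp. 132–136);
  Thm. 9.12 and its proof, (9.37)–(9.38) (p. 260). [LemarieRieusset2016]
* H. Koch, D. Tataru, Adv. Math. 157 (2001), §2 (8), §3 (11), (14). [KochTataruAdvMath2001]
* E. B. Fabes, B. F. Jones, N. M. Rivière, ARMA 45 (1972), Thm. 2.1. [FabesJonesRiviere1972]
* H. Bahouri, J.-Y. Chemin, R. Danchin, *Fourier Analysis and Nonlinear PDE* (2011), Def. 1.26.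
-/

noncomputable section

open MeasureTheory TemperedDistribution Set Function Filter
open _root_.Topology
open scoped SchwartzMap ENNReal NNReal RealInnerProductSpace

namespace Literature.Analysis.FluidPDE

/-! ## The bilinear Duhamel term with general viscosity and initial time -/

section Oseen

variable {E : Type*} [NormedAddCommGroup E] [InnerProductSpace ℝ E] [FiniteDimensional ℝ E]
  [MeasurableSpace E] [BorelSpace E]

/-- **The bilinear Duhamel (Oseen) term** with viscosity `ν` and initial time `s`,
`B^ν_s(u, v)(t)(x) = ∫_{τ ∈ (s,t)} ∫ K(ν(t-τ), x-y)[u(τ,y), v(τ,y)] dy dτ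
 = (∫ₛᵗ e^{ν(t-τ)Δ} P ∇·(u ⊗ v)(τ) dτ)(x)`, `K = oseenKernel` the kernel of `e^{σΔ} P ∇·` on
rank-one tensors (KNSS 2009, §3 p. 6, the representation formula with `f_{jk} = -u_k v_j`, and
§4 p. 8: `B(u,v)ᵢ = -∫₀ᵗ∫ K_{ijk}(x-y,t-s) u_k(y,s) v_j(y,s) dy ds`; our `B^ν_s(u,v)` is `-B(u,v)`
of KNSS, so that the integral equation reads `u(t) = e^{ν(t-s)Δ}u(s) - B^ν_s(u,u)(t)`;
Lemarié-Rieusset 2016, (6.12) and Def. 6.11, `B_ν`). Iterated Bochner integrals, junk `0` where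
divergent; for fields essentially bounded on `(s, t) × E` the integral converges absolutely at
every `(t, x)` by the kernel bound (14) (`exists_lintegral_enorm_oseenKernel_le`). [cite: KochNadirashviliSereginSverak2009, §4 p. 8, the bilinear form B (arXiv:0709.3599)] -/
def oseenDuhamel (ν s : ℝ) (u v : ℝ → E → E) (t : ℝ) (x : E) : E :=
  ∫ τ in Ioo s t, ∫ y, oseenKernel (ν * (t - τ)) (x - y) (u τ y) (v τ y)

/-- Unfolding `oseenDuhamel` (KNSS 2009, §4 p. 8, `B(u,v)`). [cite: KochNadirashviliSereginSverak2009, §4 p. 8 (arXiv:0709.3599)] -/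
theorem oseenDuhamel_apply (ν s : ℝ) (u v : ℝ → E → E) (t : ℝ) (x : E) :
    oseenDuhamel ν s u v t x =
      ∫ τ in Ioo s t, ∫ y, oseenKernel (ν * (t - τ)) (x - y) (u τ y) (v τ y) := rfl

/-- `B^ν_s(0, v) = 0` (bilinearity; KNSS 2009, §4 p. 8). [cite: KochNadirashviliSereginSverak2009, §4 p. 8 (arXiv:0709.3599)] -/
@[simp]
theorem oseenDuhamel_zero_left (ν s : ℝ) (v : ℝ → E → E) : oseenDuhamel ν s 0 v = 0 := by
  funext t x
  simp [oseenDuhamel]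

/-- `B^ν_s(u, 0) = 0` (bilinearity; KNSS 2009, §4 p. 8). [cite: KochNadirashviliSereginSverak2009, §4 p. 8 (arXiv:0709.3599)] -/
@[simp]
theorem oseenDuhamel_zero_right (ν s : ℝ) (u : ℝ → E → E) : oseenDuhamel ν s u 0 = 0 := by
  funext t x
  simp [oseenDuhamel]

/-- Koch–Tataru's bilinear operator is the case `ν = 1`, `s = 0`:
`kochTataruBilinear u v = B^1_0(u, v)` (Koch–Tataru 2001, (11)). [cite: KochTataruAdvMath2001, §3 (11)] -/
theorem kochTataruBilinear_eq_oseenDuhamel (u v : ℝ → E → E) :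
    kochTataruBilinear u v = oseenDuhamel 1 0 u v := by
  funext t x
  simp [kochTataruBilinear, oseenDuhamel]

end Oseen

/-! ## A field with a tempered distribution is integrable against Gaussians -/

section Datum

variable {ι : Type*} [Fintype ι] {E : Type*} [NormedAddCommGroup E] [InnerProductSpace ℝ E]
  [FiniteDimensional ℝ E] [MeasurableSpace E] [BorelSpace E]

/-- If `U` is the tempered distribution of the field `u₀` (`IsDistributionOf u₀ U`: `φ • u₀` is
integrable for every Schwartz `φ`), then `u₀` is integrable against every Gauss–Weierstrass
kernel: `∫ G_a(y) ‖u₀(y)‖ dy < ∞`, `0 < a` — test with the Schwartz heat kernel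
`Literature.Analysis.FunctionSpaces.heatKernelSchwartz` (BCD §1.2, `L¹_loc ∩ 𝓢' ⊂ 𝓢'`). This is
what makes the caloric extension `heatExtension u₀ (ν t)` of a Besov datum an honest integral. [folklore] -/
theorem IsDistributionOf.integrable_heatKernel_mul_norm {u₀ : E → EuclideanSpace ℝ ι}
    {U : 𝓢'(E, EuclideanSpace ℂ ι)} (hU : IsDistributionOf u₀ U) {a : ℝ} (ha : 0 < a) :
    Integrable (fun y => UnboundedOperators.heatKernel a y * ‖u₀ y‖) volume := by
  have h := (hU (FunctionSpaces.heatKernelSchwartz E a)).1.norm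
  refine h.congr (Eventually.of_forall fun y => ?_)
  simp only [norm_smul, FunctionSpaces.heatKernelSchwartz_apply ha, Complex.norm_real,
    Real.norm_eq_abs, FunctionSpaces.EuclideanSpace.norm_complexify,
    abs_of_pos (UnboundedOperators.heatKernel_pos ha y)]

end Datum

/-! ## The four named facts -/

section Facts

/-- Local notation for physical space `ℝ³ = EuclideanSpace ℝ (Fin 3)`. -/
local notation "ℝ³" => EuclideanSpace ℝ (Fin 3)

/-- Local notation for the complexified target `ℂ³ = EuclideanSpace ℂ (Fin 3)`. -/
local notation "ℂ³" => EuclideanSpace ℂ (Fin 3)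

/-- **(A) Duality form ⇒ integral (Oseen) form for bounded Besov mild solutions**
(Lemarié-Rieusset 2016, Thm. 6.1, (6.11) ⇒ (6.12), with Prop. 6.5 and Lemma 6.4 (B): a very
weak solution of Navier–Stokes which vanishes at infinity is an Oseen solution, i.e. solves the
integral equation `u = W_{νt} ∗ u₀ - ∫₀ᵗ Σⱼ ∂ⱼ𝒪(ν(t-s)) :: (uⱼ u) ds`; Koch–Nadirashvili–Seregin–
Šverák 2009, §4 (i) p. 8 with §3 p. 6: the mild form `uᵢ = Γ ∗ u₀ᵢ + ∫∫ K_{ijk}(x-y,t-s) f_{jk}`,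
`f_{jk} = -u_k u_j`, and Lemma 3.1 / Rem. 3.1 (p. 7) for the `L^∞` uniqueness up to the drift
`b(t)`;
the drift is excluded here by the realisation condition `Ṡ_j U(t) → 0` (`j → -∞`) of
`MemHomBesov`, Bahouri–Chemin–Danchin Def. 1.26, valid at every `t ∈ [0, T)`). In the tree's
vocabulary: let `ν > 0`, `3 < p < ∞`, `1 ≤ q < ∞`, and let `(u, U)` be a Besov mild solution on
`[0, T)` (class `(-1 + 3/p, p, q)`, duality form from the datum `u 0`) whose slices are uniformly
essentially bounded on every `(0, T₁)`, `T₁ < T`. Then for every `t ∈ (0, T)`,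
`u(t) = e^{νtΔ} u(0) - B^ν_0(u, u)(t)` almost everywhere, both terms being absolutely convergent
integrals (`heatExtension (u 0) (ν t)`: the datum is integrable against Gaussians,
`IsDistributionOf.integrable_heatKernel_mul_norm`; `oseenDuhamel ν 0 u u t`: kernel bound (14)).
The hypotheses are literally those of `knss_classical_of_bounded_isBesovMildSolutionOn`. Note
that the printed hypotheses of Lemarié-Rieusset's Thm. 6.1 / Prop. 6.5 (`u ∈ L²_t L²((1+|x|)⁻³dx)`
or `u` in the closure of `𝒟` in `(L²L²)_uloc`) are *not* met by bounded fields — that gap is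
exactly KNSS's drift `b(t)` — so the cited results give the mechanism (very weak ⇒ Oseen for
fields vanishing at infinity), while the vanishing at infinity is supplied here by the
realisation clause of `MemHomBesov`; the argument is the tree's own (see the DAG in the module
docstring). [cite: LemarieRieusset2016, Thm. 6.1 with Prop. 6.5 and Lemma 6.4 (B) (pp. 133–136)] -/
def oseenMild_of_bounded_isBesovMildSolutionOn : Prop :=
  ∀ ⦃ν T : ℝ⦄, 0 < ν → 0 < T → ∀ ⦃p q : ℝ≥0∞⦄ [Fact (1 ≤ p)], 3 < p → p < ∞ → 1 ≤ q → q < ∞ →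
    ∀ ⦃u : ℝ → ℝ³ → ℝ³⦄ ⦃U : ℝ → 𝓢'(ℝ³, ℂ³)⦄,
      IsBesovMildSolutionOn (-1 + 3 / p.toReal) p q T ν u U →
        (∀ T₁ ∈ Ioo 0 T, ∃ C : ℝ≥0∞, C < ∞ ∧ ∀ t ∈ Ioo 0 T₁, eLpNorm (u t) ∞ volume ≤ C) →
          ∀ t ∈ Ioo 0 T, u t =ᵐ[volume] fun x =>
            UnboundedOperators.heatExtension (u 0) (ν * t) x - oseenDuhamel ν 0 u u t x

variable (E : Type*) [NormedAddCommGroup E] [InnerProductSpace ℝ E] [FiniteDimensional ℝ E]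
  [MeasurableSpace E] [BorelSpace E]

/-- **(R) Restart of the integral equation at a positive time** (the semigroup property of the
Oseen formulation: Koch–Nadirashvili–Seregin–Šverák 2009, §4 p. 8, `u = U + B(u,u)` treated "as
an ODE in `t`" on `L^∞_{x,t}(ℝⁿ × (0,T'))`, Rem. 4.1; Lemarié-Rieusset 2016, proof of Thm. 9.12,
(9.38):
for `t₀ ∈ (T₀, T₁)` the bounded mild solution is given for `t > t₀` by the Oseen iteration from
`V₀ = W_{ν(t-t₀)} ∗ u(t₀)`). Let `ν > 0` and let `u` be jointly measurable on `(0, T) × E` with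
measurable initial slice and slices uniformly essentially bounded on every `[0, T₁)`, `T₁ < T`
(datum included: in the application the datum of a bounded Besov mild solution is bounded by the
same constant, `eLpNorm_top_zero_le_of_continuousInHomBesovOn`), such that
`u(t) = e^{νtΔ}u(0) - B^ν_0(u,u)(t)` a.e. for every `t ∈ (0, T)`. Then for all `0 < s < t < T`,
`u(t) = e^{ν(t-s)Δ}u(s) - B^ν_s(u,u)(t)` a.e. Mechanism: the semigroup laws
`e^{aΔ}e^{bΔ} = e^{(a+b)Δ}` for bounded data (`heatExtension_add_holds`, `p = ∞`) and
`e^{aΔ} K(b) = K(a+b)` for the Oseen kernel, and Fubini under the bound (14). [cite: KochNadirashviliSereginSverak2009, §4 p. 8 (u = U + B(u,u) as an ODE in t) and Rem. 4.1 (arXiv:0709.3599)] -/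
def oseenMild_restart : Prop :=
  ∀ ⦃ν T : ℝ⦄, 0 < ν → 0 < T → ∀ ⦃u : ℝ → E → E⦄,
    AEStronglyMeasurable (uncurry u) (volume.restrict (Ioo 0 T ×ˢ univ)) →
    AEStronglyMeasurable (u 0) volume →
    (∀ T₁ ∈ Ioo 0 T, ∃ C : ℝ≥0∞, C < ∞ ∧ ∀ t ∈ Ico 0 T₁, eLpNorm (u t) ∞ volume ≤ C) →
    (∀ t ∈ Ioo 0 T, u t =ᵐ[volume] fun x =>
      UnboundedOperators.heatExtension (u 0) (ν * t) x - oseenDuhamel ν 0 u u t x) →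
      ∀ ⦃s t : ℝ⦄, 0 < s → s < t → t < T → u t =ᵐ[volume] fun x =>
        UnboundedOperators.heatExtension (u s) (ν * (t - s)) x - oseenDuhamel ν s u u t x

/-- **(P) KNSS 2009, Proposition 4.1 (smoothing of bounded mild solutions)** (Acta Math. 203
(2009) = arXiv:0709.3599, p. 8: "Let `u ∈ L^∞_{x,t}(ℝⁿ × (0,T))` be a mild solution of [the
Cauchy problem for Navier–Stokes] with `u₀ ∈ L^∞`. Then for `k, l = 0, 1, …` the functions
`t^{k/2+l} ∇ᵏₓ ∂ₜˡ u` are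
bounded"; proof indicated there after Giga–Sawada, Dong–Du, Germain–Pavlović–Staffilani: "The
key is an estimate of `B` with the same form as [`‖B(u,v)‖ ≤ C√T‖u‖‖v‖`] but in spaces with
norms given by [`‖t^{k/2+l}∇ᵏₓ∂ₜˡu‖_∞`]"; the joint smoothness of the mild solution on
`ℝⁿ × (0, T)` is
Gallagher–Koch–Planchon 2016, (1.6), and Lemarié-Rieusset 2016, Thm. 9.12, even analytic).
General viscosity `ν > 0`, initial time `s`, any finite-dimensional `E` (KNSS: `ν = 1`, `s = 0`,
`ℝⁿ`; the viscosity is a time rescaling). **Statement.** Let `a ∈ L^∞(E)` and let `u` be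
jointly measurable on `(s, T₁) × E` with `‖a‖_∞, ‖u(t)‖_∞ ≤ M` (`t ∈ (s, T₁)`, `0 ≤ M`) and
`u(t) = e^{ν(t-s)Δ} a - B^ν_s(u,u)(t)` a.e. for every `t ∈ (s, T₁)`. Then the right-hand side
`w(t, x) = e^{ν(t-s)Δ}a (x) - B^ν_s(u,u)(t)(x)` — the canonical representative of the class
`u ∈ L^∞_{x,t}` — is jointly `C^∞` on `(s, T₁) × E`, bounded by `M`, and for all `k, l` the
weighted derivatives `(t-s)^{k/2+l} ‖∇ᵏₓ ∂ₜˡ w(t, x)‖` are bounded on `(s, T₁) × E`. The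
quantitative short-time estimate of Prop. 4.1 and Lemma 4.1 are not vendored. [cite: KochNadirashviliSereginSverak2009, Prop. 4.1 (arXiv:0709.3599 p. 8)] -/
def knss2009_smoothing : Prop :=
  ∀ ⦃ν : ℝ⦄, 0 < ν → ∀ ⦃s T₁ : ℝ⦄, s < T₁ → ∀ ⦃a : E → E⦄ ⦃u : ℝ → E → E⦄ ⦃M : ℝ⦄, 0 ≤ M →
    AEStronglyMeasurable a volume → eLpNorm a ∞ volume ≤ ENNReal.ofReal M →
    AEStronglyMeasurable (uncurry u) (volume.restrict (Ioo s T₁ ×ˢ univ)) →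
    (∀ t ∈ Ioo s T₁, eLpNorm (u t) ∞ volume ≤ ENNReal.ofReal M) →
    (∀ t ∈ Ioo s T₁, u t =ᵐ[volume] fun x =>
      UnboundedOperators.heatExtension a (ν * (t - s)) x - oseenDuhamel ν s u u t x) →
      IsSmoothSpaceTimeOn (Ioo s T₁)
          (fun t x => UnboundedOperators.heatExtension a (ν * (t - s)) x - oseenDuhamel ν s u u t x) ∧
        (∀ t ∈ Ioo s T₁, ∀ x,
          ‖UnboundedOperators.heatExtension a (ν * (t - s)) x - oseenDuhamel ν s u u t x‖ ≤ M) ∧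
        ∀ k l : ℕ, ∃ C : ℝ, ∀ t ∈ Ioo s T₁, ∀ x,
          (t - s) ^ ((k : ℝ) / 2 + l) *
              ‖iteratedFDeriv ℝ k (fun y => iteratedDeriv l
                (fun τ => UnboundedOperators.heatExtension a (ν * (τ - s)) y - oseenDuhamel ν s u u τ y)
                t) x‖ ≤ C

/-- **(C) Smooth mild solutions are classical** (Fabes–Jones–Rivière 1972, Thm. 2.1, the
equivalence of the duality ("very weak") form with the equations for regular fields;
Lemarié-Rieusset 2016, Thm. 6.1 (6.12) ⇒ (6.11) and Lemma 6.4 (A): an Oseen/mild solution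
solves `∂ₜu = νΔu - P∇·(u ⊗ u)`, i.e. the Navier–Stokes system with the pressure `∇p =
(Id - P)(-∇·(u ⊗ u))`; for smooth fields the pressure is reconstructed from the projected
equation by de Rham–Poincaré, `exists_isClassicalNSSolutionOn_of_forall_integral_inner_eq_zero`).
**Statement.** Let `ν > 0`, let `u₀ : E → E` be measurable and integrable against Gaussians
(so that the datum pairings `∫⟪u₀, e^{νtΔ}φ⟫` are honest integrals), and let `v` be
jointly `C^∞` on `(0, T) × E` with slices uniformly essentially bounded on every `(0, T₁)`,
`T₁ < T`, and a mild solution on `(0, T)` in the duality form from the datum `u₀`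
(`Fluid.IsMildNSSolutionOn (Ioo 0 T) ν 0 u₀ v`: weakly divergence-free slices and, for every
solenoidal test `φ`, `∫⟪v(t), φ⟫ = ∫⟪u₀, e^{νtΔ}φ⟫ + ∫₀ᵗ∫⟪v, (v·∇)e^{ν(t-τ)Δ}φ⟫ dτ`). Then
`(v, π)` is a classical solution of the unforced system on `(0, T)` for some smooth pressure `π`.
Mechanism: differentiate the identity in `t` (`∂ₜe^{νtΔ}φ = νe^{νtΔ}Δφ`, Leibniz rule for the
Duhamel integral, the identity tested with `νΔφ`) to get
`∫⟪∂ₜv + (v·∇)v - νΔv, φ⟫ = 0` for solenoidal tests. [cite: FabesJonesRiviere1972, Thm. 2.1] -/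
def classical_of_smooth_isMildNSSolutionOn : Prop :=
  ∀ ⦃ν T : ℝ⦄, 0 < ν → 0 < T → ∀ ⦃u₀ : E → E⦄ ⦃v : ℝ → E → E⦄, AEStronglyMeasurable u₀ volume →
    (∀ a : ℝ, 0 < a → Integrable (fun y => UnboundedOperators.heatKernel a y * ‖u₀ y‖) volume) →
    IsSmoothSpaceTimeOn (Ioo 0 T) v →
    (∀ T₁ ∈ Ioo 0 T, ∃ C : ℝ≥0∞, C < ∞ ∧ ∀ t ∈ Ioo 0 T₁, eLpNorm (v t) ∞ volume ≤ C) →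
    FluidPDE.IsMildNSSolutionOn (Ioo 0 T) ν 0 u₀ v →
      ∃ π : ℝ → E → ℝ, FluidPDE.IsClassicalNSSolutionOn (Ioo 0 T) ν 0 v π

end Facts

/-! ## The reduction -/

section Assembly

/-- Local notation for physical space `ℝ³ = EuclideanSpace ℝ (Fin 3)`. -/
local notation "ℝ³" => EuclideanSpace ℝ (Fin 3)

/-- Local notation for the complexified target `ℂ³ = EuclideanSpace ℂ (Fin 3)`. -/
local notation "ℂ³" => EuclideanSpace ℂ (Fin 3)

variable {E : Type*} [NormedAddCommGroup E] [InnerProductSpace ℝ E] [FiniteDimensional ℝ E]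
  [MeasurableSpace E] [BorelSpace E]

/-- **Transfer of the duality-form identities along a.e. equality of slices.** If `u` is a mild
solution on `(0, T)` in the duality form (datum `u₀`, force `0`) and `v t = u t` a.e. for every
`t ∈ (0, T)`, then so is `v`, from the same datum: every term of the identities sees the positive
time slices only through the integrals `∫ ⟪·, ψ⟫`, `∫ ⟪·, (·∙∇)ψ⟫` (Fabes–Jones–Rivière 1972,
Thm. 2.1: the duality form is a statement about the class of `u`). [cite: FabesJonesRiviere1972, Thm. 2.1] -/
theorem IsMildNSSolutionOn.congr_ae_Ioo {ν T : ℝ} {u₀ : E → E} {u v : ℝ → E → E}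
    (h : FluidPDE.IsMildNSSolutionOn (Ioo 0 T) ν 0 u₀ u)
    (hvu : ∀ t ∈ Ioo 0 T, v t =ᵐ[volume] u t) :
    FluidPDE.IsMildNSSolutionOn (Ioo 0 T) ν 0 u₀ v := by
  refine ⟨fun t ht θ hθ => ?_, fun t ht φ hφ hdiv => ?_⟩
  · have e : ∫ x, ⟪v t x, gradient θ x⟫ = ∫ x, ⟪u t x, gradient θ x⟫ :=
      integral_congr_ae ((hvu t ht).mono fun x hx => by simp only [hx])
    rw [e]
    exact h.1 t ht θ hθ
  · have key := h.2 t ht φ hφ hdiv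
    have e1 : ∫ x, ⟪v t x, φ x⟫ = ∫ x, ⟪u t x, φ x⟫ :=
      integral_congr_ae ((hvu t ht).mono fun x hx => by simp only [hx])
    have e2 : (∫ τ in (0 : ℝ)..t, ∫ x, ⟪v τ x, convect (v τ) (heatTest ν φ (t - τ)) x⟫) =
        ∫ τ in (0 : ℝ)..t, ∫ x, ⟪u τ x, convect (u τ) (heatTest ν φ (t - τ)) x⟫ := by
      refine intervalIntegral.integral_congr_ae (Eventually.of_forall fun τ hτ => ?_)
      rw [uIoc_of_le ht.1.le] at hτ
      have hτ' : τ ∈ Ioo 0 T := ⟨hτ.1, hτ.2.trans_lt ht.2⟩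
      exact integral_congr_ae ((hvu τ hτ').mono fun x hx => by simp only [convect_apply, hx])
    rw [e1, e2]
    exact key

/-- **The smoothing fact from the Oseen architecture** (KNSS 2009, §4 with Prop. 4.1;
Lemarié-Rieusset 2016, Thm. 6.1; Fabes–Jones–Rivière 1972, Thm. 2.1):
`knss_classical_of_bounded_isBesovMildSolutionOn` follows from (A) duality ⇒ integral form,
(R) restart, (P) Prop. 4.1 and (C) smooth mild ⇒ classical. Proof: by (A) and (R),
`u(t) = w_s(t)` a.e. for `0 < s < t < T`, `w_s(t) = e^{ν(t-s)Δ}u(s) - B^ν_s(u,u)(t)`; by (P) on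
`(s, T₁)` (datum `u(s) ∈ L^∞`, bound from the slab `(0, T₁)`) each `w_s` is jointly smooth on
`(s, T₁) × ℝ³`; continuous slices a.e. equal to `u(t)` coincide, so `v(t) = w_{t/2}(t)` equals
`w_s(t)` for every `s < t` and is jointly smooth on `(0, T) × ℝ³`; `v` inherits the duality-form
identities and the slice bounds from `u` (`IsMildNSSolutionOn.congr_ae_Ioo`), its datum `u(0)`
is integrable against Gaussians (`IsDistributionOf.integrable_heatKernel_mul_norm`), and (C) gives
the pressure. [cite: KochNadirashviliSereginSverak2009, §4 with Prop. 4.1 (arXiv:0709.3599 p. 8)] -/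
theorem knss_classical_of_bounded_isBesovMildSolutionOn_of_oseen
    (hA : oseenMild_of_bounded_isBesovMildSolutionOn) (hR : oseenMild_restart ℝ³)
    (hP : knss2009_smoothing ℝ³) (hC : classical_of_smooth_isMildNSSolutionOn ℝ³) :
    knss_classical_of_bounded_isBesovMildSolutionOn := by
  intro ν T hν hT p q _ hp₃ hp hq₁ hq u U hB hbd
  -- (A): the integral equation from the datum, a.e. at every positive time
  have hA' := hA hν hT hp₃ hp hq₁ hq hB hbd
  have hdat : ∀ a : ℝ, 0 < a →
      Integrable (fun y => UnboundedOperators.heatKernel a y * ‖u 0 y‖) volume :=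
    fun a ha => (hB.isDistributionOf 0 ⟨le_rfl, hT⟩).integrable_heatKernel_mul_norm ha
  have hmeas : AEStronglyMeasurable (uncurry u) (volume.restrict (Ioo 0 T ×ˢ univ)) :=
    hB.aestronglyMeasurable
  have hmeas₀ : AEStronglyMeasurable (u 0) volume :=
    (hB.isDistributionOf 0 ⟨le_rfl, hT⟩).aestronglyMeasurable
  -- the datum is bounded by the same constants (Besov continuity at `t = 0`)
  have hbd₀ : ∀ T₁ ∈ Ioo 0 T, ∃ C : ℝ≥0∞, C < ∞ ∧ ∀ t ∈ Ico 0 T₁, eLpNorm (u t) ∞ volume ≤ C := by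
    intro T₁ hT₁
    obtain ⟨C, hC, hCb⟩ := hbd T₁ hT₁
    have hs := gkp_index_mem_Ioo hp₃ hp
    have h0 : eLpNorm (u 0) ∞ volume ≤ C :=
      eLpNorm_top_zero_le_of_continuousInHomBesovOn hs.2 (by linarith [hs.1]) hq₁ hT₁.1 hT₁.2.le
        hB.continuousInHomBesovOn hB.isDistributionOf hC hCb
    refine ⟨C, hC, fun t ht => ?_⟩
    rcases ht.1.eq_or_lt with h | h
    · rw [← h]; exact h0
    · exact hCb t ⟨h, ht.2⟩
  -- (R): restart at every positive time
  have hR' : ∀ ⦃s t : ℝ⦄, 0 < s → s < t → t < T → u t =ᵐ[volume] fun x =>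
      UnboundedOperators.heatExtension (u s) (ν * (t - s)) x - oseenDuhamel ν s u u t x :=
    hR hν hT hmeas hmeas₀ hbd₀ hA'
  -- the smooth representatives `w s` on `(s, T₁) × ℝ³`, by (P)
  set w : ℝ → ℝ → ℝ³ → ℝ³ := fun s t x =>
    UnboundedOperators.heatExtension (u s) (ν * (t - s)) x - oseenDuhamel ν s u u t x with hw
  have hP' : ∀ ⦃s T₁ : ℝ⦄, 0 < s → s < T₁ → T₁ < T → IsSmoothSpaceTimeOn (Ioo s T₁) (w s) := by
    intro s T₁ hs hsT₁ hT₁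
    obtain ⟨C, hC, hCb⟩ := hbd T₁ ⟨hs.trans hsT₁, hT₁⟩
    have hCM : C = ENNReal.ofReal C.toReal := (ENNReal.ofReal_toReal hC.ne).symm
    have ha : eLpNorm (u s) ∞ volume ≤ ENNReal.ofReal C.toReal := hCM ▸ hCb s ⟨hs, hsT₁⟩
    have hb : ∀ t ∈ Ioo s T₁, eLpNorm (u t) ∞ volume ≤ ENNReal.ofReal C.toReal :=
      fun t ht => hCM ▸ hCb t ⟨hs.trans ht.1, ht.2⟩
    have hmeas_s : AEStronglyMeasurable (uncurry u) (volume.restrict (Ioo s T₁ ×ˢ univ)) :=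
      hmeas.mono_measure
        (Measure.restrict_mono (prod_mono (Ioo_subset_Ioo hs.le hT₁.le) Subset.rfl) le_rfl)
    have hsl : AEStronglyMeasurable (u s) volume :=
      (hB.isDistributionOf s ⟨hs.le, hsT₁.trans hT₁⟩).aestronglyMeasurable
    exact (hP hν hsT₁ ENNReal.toReal_nonneg hsl ha hmeas_s hb
      (fun t ht => hR' hs ht.1 (ht.2.trans hT₁))).1
  -- `w s t = u t` a.e., and slices of `w s` are continuous
  have hwu : ∀ ⦃s t : ℝ⦄, 0 < s → s < t → t < T → w s t =ᵐ[volume] u t :=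
    fun s t hs hst htT => (hR' hs hst htT).symm
  have hwcont : ∀ ⦃s t : ℝ⦄, 0 < s → s < t → t < T → Continuous (w s t) := by
    intro s t hs hst htT
    have h1 := hP' hs (show s < (t + T) / 2 by linarith) (by linarith)
    exact (h1.contDiff_slice ⟨hst, by linarith⟩).continuous
  -- any two representatives agree where both are defined
  have hagree : ∀ ⦃s s' t : ℝ⦄, 0 < s → s < t → 0 < s' → s' < t → t < T → w s t = w s' t :=
    fun s s' t hs hst hs' hs't htT =>
      eq_of_ae_eq_of_continuous (hwcont hs hst htT) (hwcont hs' hs't htT)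
        ((hwu hs hst htT).trans (hwu hs' hs't htT).symm)
  -- the global representative
  set v : ℝ → ℝ³ → ℝ³ := fun t => w (t / 2) t with hv
  have hvw : ∀ ⦃s t : ℝ⦄, 0 < s → s < t → t < T → v t = w s t := fun s t hs hst htT =>
    hagree (half_pos (hs.trans hst)) (half_lt_self (hs.trans hst)) hs hst htT
  have hvu : ∀ t ∈ Ioo 0 T, v t =ᵐ[volume] u t := fun t ht =>
    hwu (half_pos ht.1) (half_lt_self ht.1) ht.2
  -- `v` is jointly smooth on `(0, T) × ℝ³`
  have hvsmooth : IsSmoothSpaceTimeOn (Ioo 0 T) v := by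
    refine contDiffOn_of_locally_contDiffOn fun z hz => ?_
    obtain ⟨ht, -⟩ := mem_prod.1 hz
    set s : ℝ := z.1 / 2 with hs
    set T₁ : ℝ := (z.1 + T) / 2 with hT₁
    have hs0 : 0 < s := half_pos ht.1
    have hsz : s < z.1 := half_lt_self ht.1
    have hzT₁ : z.1 < T₁ := by rw [hT₁]; linarith [ht.2]
    have hT₁T : T₁ < T := by rw [hT₁]; linarith [ht.2]
    refine ⟨Ioo s T₁ ×ˢ univ, (isOpen_Ioo.prod isOpen_univ), mk_mem_prod ⟨hsz, hzT₁⟩ (mem_univ _),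
      ?_⟩
    have hsub : (Ioo 0 T ×ˢ (univ : Set ℝ³)) ∩ Ioo s T₁ ×ˢ univ = Ioo s T₁ ×ˢ univ := by
      rw [inter_eq_right]
      exact prod_mono (Ioo_subset_Ioo hs0.le hT₁T.le) Subset.rfl
    rw [hsub]
    refine (hP' hs0 (hsz.trans hzT₁) hT₁T).congr fun y hy => ?_
    obtain ⟨hy1, -⟩ := mem_prod.1 hy
    change v y.1 y.2 = w s y.1 y.2
    rw [hvw hs0 hy1.1 (hy1.2.trans hT₁T)]
  -- the slice bounds and the duality-form identities transfer to `v`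
  have hvbd : ∀ T₁ ∈ Ioo 0 T, ∃ C : ℝ≥0∞, C < ∞ ∧ ∀ t ∈ Ioo 0 T₁, eLpNorm (v t) ∞ volume ≤ C := by
    intro T₁ hT₁
    obtain ⟨C, hC, hCb⟩ := hbd T₁ hT₁
    refine ⟨C, hC, fun t ht => ?_⟩
    rw [eLpNorm_congr_ae (hvu t ⟨ht.1, ht.2.trans hT₁.2⟩)]
    exact hCb t ht
  have hvmild : FluidPDE.IsMildNSSolutionOn (Ioo 0 T) ν 0 (u 0) v :=
    IsMildNSSolutionOn.congr_ae_Ioo (hB.mild.mono Ioo_subset_Ico_self) hvu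
  -- (C): the pressure
  obtain ⟨π, hcl⟩ := hC hν hT hmeas₀ hdat hvsmooth hvbd hvmild
  exact ⟨v, π, hcl, fun t ht => (hvu t ht).symm⟩

end Assembly

end Literature.Analysis.FluidPDE

end
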